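import Summits.CriticalPhenomena.PercolationContinuityZ3.Theorems.SahiMasterFamilyPointwiseCoordinateGluing

/-!
# One-coordinate gluing, III: two members CONDITIONALLY INDEPENDENT given a coordinate, the third absorbing them on the `1`-side —
# an unconditional `C_3` + pointwise-(EQ-3) class with an explicit identity

Unit `prim-master-conj` (crux anchor stmt-CriticalPhenomena-4575, helper work), gen 15; memo
`run/shared/lean/prim/prim-l12/prim-master-conj/POINTWISE.md` §16.  Notation: `t = p_e`, `X^b = secAt e b X`, `m = μ_p`, `ν_X = m X¹ − m X⁰`.

THE CLASS.  Increasing `A, B, D` and a coordinate `e` such that: the `e`-sections of `A` are determined by a coordinate set `F`, those of `B` by `Fᶜ`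
(so `A` and `B` are independent GIVEN the coordinate `e` — they may both depend on `e`), and `D¹ ⊇ A¹ ∪ B¹` (on the half-cube `{e ∈ ω}` the
third member contains the other two; `C := D⁰` and `G := D¹ ⊇ C` are otherwise arbitrary).  Neither a `Z_2`-deletion (A, B share `e`) nor an
absorbing member (`D⁰` is free) nor one of the degenerate shapes of parts I–II; the non-degenerate good-coordinate frontier at `n = 5` (memo §16)
starts with such triples, e.g. `(x₀x₁ ∨ x₄(x₀∨x₁), x₂ ∨ x₃x₄, x₃ ∨ x₄(x₀∨x₁∨x₂))`.

THE IDENTITY (`sahiE_three_blocks_eq`; a `ring` identity after conditioning on `e`, the four block factorisations `m(A^b ∩ B^{b'}) = m A^b·m B^{b'}`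
and `X, Y ⊆ G`):
  `E_3(A, B, D) = (1−t)³·[Cov(A⁰, B⁰∩C) + Cov(B⁰, A⁰∩C)]`
  `  + t(1−t)²·[Cov(Y, A⁰∩C) + Cov(X, B⁰∩C) + Cov(A⁰, B⁰∩C) + Cov(B⁰, A⁰∩C) + m(A⁰ ∩ (Y∖B⁰) ∩ Cᶜ) + m(B⁰ ∩ (X∖A⁰) ∩ Cᶜ) + (2 − m C)·ν_A ν_B]`
  `  + t²(1−t)·[Cov(X, B⁰∩C) + Cov(Y, A⁰∩C) + m(A⁰ ∩ (Y∖B⁰) ∩ Cᶜ) + m(B⁰ ∩ (X∖A⁰) ∩ Cᶜ) + (2 − m G)·ν_A ν_B]`     (`X = A¹`, `Y = B¹`),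
every piece a Harris covariance of increasing events, a probability, or a product of influences.  CONSEQUENCES: `sahiE_three_blocks_nonneg` — `C_3`
on the class at every `p`, UNCONDITIONALLY; `sahiE_three_blocks_settled` — at interior `p`, `E_3 = 0 ↔ Z_3` (each atom's vanishing is parameter-free,
so a zero propagates to the open cube and (EQI-3) applies).
HONEST FRAMING: a class theorem; Kahn's Conjecture 5 / `MasterFamilyEqIff 3` remain OPEN.  Axioms standard. [this work]
-/

noncomputable section

open scoped Classical

namespace Summit.CriticalPhenomena.PercolationContinuityZ3.Theorems

open Finset Function
open Literature.Combinatorics.Sahi2008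
open Literature.Probability.Percolation (DeterminedBy)
open Literature.Probability.Percolation.DecisionTree (ind ind_of_mem ind_of_not_mem ind_nonneg)
open SahiCombDisjunct

namespace Pointwise

variable {ι : Type} [Fintype ι]

/-! ### 0. Two more atoms -/

/-- The cell `μ(A ∩ (Y ∖ B) ∩ Cᶜ) = μ(A∩Y) − μ(A∩Y∩C) − μ(A∩B) + μ(A∩B∩C)` for `B ⊆ Y`. [folklore] -/
theorem ex_ind_inter_sdiff_inter_compl (μ : Set ι → ℝ) (A : Set (Set ι)) {B Y : Set (Set ι)} (hBY : B ⊆ Y) (C : Set (Set ι)) :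
    ex μ (ind (A ∩ (Y \ B) ∩ Cᶜ)) = ex μ (ind (A ∩ Y)) - ex μ (ind (A ∩ Y ∩ C)) - ex μ (ind (A ∩ B)) + ex μ (ind (A ∩ B ∩ C)) := by
  have h : ind (A ∩ (Y \ B) ∩ Cᶜ) = ind (A ∩ Y) - ind (A ∩ Y ∩ C) - ind (A ∩ B) + ind (A ∩ B ∩ C) := by
    funext ω
    simp only [Pi.add_apply, Pi.sub_apply, Literature.Probability.Percolation.BHK2006.ind_inter, ind_compl_apply, ind_sdiff_of_subset hBY]
    ring
  rw [h, ex_add, ex_sub', ex_sub']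

/-- An event contained in another has the same intersection-moment: `m(X ∩ G) = m X` for `X ⊆ G`. [folklore] -/
theorem ex_ind_inter_of_subset (μ : Set ι → ℝ) {X G : Set (Set ι)} (h : X ⊆ G) : ex μ (ind (X ∩ G)) = ex μ (ind X) := by
  rw [Set.inter_eq_left.2 h]

/-! ### 1. The identity -/

section Identity

variable (p : ι → unitInterval) (e : ι) (F : Finset ι) (A B D : Set (Set ι))
  (hA : ∀ b : Bool, DeterminedBy (secAt e b A) (↑F : Set ι)) (hB : ∀ b : Bool, DeterminedBy (secAt e b B) (↑F : Set ι)ᶜ)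
  (hDA : secAt e true A ⊆ secAt e true D) (hDB : secAt e true B ⊆ secAt e true D)
include hA hB hDA hDB

/-- **Identity (C), conditionally independent pair absorbed on the `1`-side** (notation of the file header; `X = A¹, Y = B¹, C = D⁰, G = D¹`;
the cells `m(A⁰∩(Y∖B⁰)∩Cᶜ)`, `m(B⁰∩(X∖A⁰)∩Cᶜ)` are written in inclusion–exclusion form with the block factorisations applied, cf.
`ex_ind_inter_sdiff_inter_compl`). [this work] -/
theorem sahiE_three_blocks_eq :
    sahiE (bernoulliWeight p) 3 ![ind A, ind B, ind D] =
      (1 - (p e : ℝ)) ^ 3 *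
        ((ex (bernoulliWeight p) (ind (secAt e false A ∩ secAt e false B ∩ secAt e false D)) -
            ex (bernoulliWeight p) (ind (secAt e false A)) * ex (bernoulliWeight p) (ind (secAt e false B ∩ secAt e false D)))
          + (ex (bernoulliWeight p) (ind (secAt e false A ∩ secAt e false B ∩ secAt e false D)) -
            ex (bernoulliWeight p) (ind (secAt e false B)) * ex (bernoulliWeight p) (ind (secAt e false A ∩ secAt e false D))))
      + (p e : ℝ) * (1 - (p e : ℝ)) ^ 2 *
        ((ex (bernoulliWeight p) (ind (secAt e true B ∩ (secAt e false A ∩ secAt e false D))) -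
            ex (bernoulliWeight p) (ind (secAt e true B)) * ex (bernoulliWeight p) (ind (secAt e false A ∩ secAt e false D)))
          + (ex (bernoulliWeight p) (ind (secAt e true A ∩ (secAt e false B ∩ secAt e false D))) -
            ex (bernoulliWeight p) (ind (secAt e true A)) * ex (bernoulliWeight p) (ind (secAt e false B ∩ secAt e false D)))
          + (ex (bernoulliWeight p) (ind (secAt e false A ∩ secAt e false B ∩ secAt e false D)) -
            ex (bernoulliWeight p) (ind (secAt e false A)) * ex (bernoulliWeight p) (ind (secAt e false B ∩ secAt e false D)))
          + (ex (bernoulliWeight p) (ind (secAt e false A ∩ secAt e false B ∩ secAt e false D)) -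
            ex (bernoulliWeight p) (ind (secAt e false B)) * ex (bernoulliWeight p) (ind (secAt e false A ∩ secAt e false D)))
          + (ex (bernoulliWeight p) (ind (secAt e false A)) * ex (bernoulliWeight p) (ind (secAt e true B))
              - ex (bernoulliWeight p) (ind (secAt e true B ∩ (secAt e false A ∩ secAt e false D)))
              - ex (bernoulliWeight p) (ind (secAt e false A)) * ex (bernoulliWeight p) (ind (secAt e false B))
              + ex (bernoulliWeight p) (ind (secAt e false A ∩ secAt e false B ∩ secAt e false D)))
          + (ex (bernoulliWeight p) (ind (secAt e false B)) * ex (bernoulliWeight p) (ind (secAt e true A))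
              - ex (bernoulliWeight p) (ind (secAt e true A ∩ (secAt e false B ∩ secAt e false D)))
              - ex (bernoulliWeight p) (ind (secAt e false A)) * ex (bernoulliWeight p) (ind (secAt e false B))
              + ex (bernoulliWeight p) (ind (secAt e false A ∩ secAt e false B ∩ secAt e false D)))
          + (2 - ex (bernoulliWeight p) (ind (secAt e false D))) *
            ((ex (bernoulliWeight p) (ind (secAt e true A)) - ex (bernoulliWeight p) (ind (secAt e false A))) *
              (ex (bernoulliWeight p) (ind (secAt e true B)) - ex (bernoulliWeight p) (ind (secAt e false B)))))
      + (p e : ℝ) ^ 2 * (1 - (p e : ℝ)) *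
        ((ex (bernoulliWeight p) (ind (secAt e true A ∩ (secAt e false B ∩ secAt e false D))) -
            ex (bernoulliWeight p) (ind (secAt e true A)) * ex (bernoulliWeight p) (ind (secAt e false B ∩ secAt e false D)))
          + (ex (bernoulliWeight p) (ind (secAt e true B ∩ (secAt e false A ∩ secAt e false D))) -
            ex (bernoulliWeight p) (ind (secAt e true B)) * ex (bernoulliWeight p) (ind (secAt e false A ∩ secAt e false D)))
          + (ex (bernoulliWeight p) (ind (secAt e false A)) * ex (bernoulliWeight p) (ind (secAt e true B))
              - ex (bernoulliWeight p) (ind (secAt e true B ∩ (secAt e false A ∩ secAt e false D)))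
              - ex (bernoulliWeight p) (ind (secAt e false A)) * ex (bernoulliWeight p) (ind (secAt e false B))
              + ex (bernoulliWeight p) (ind (secAt e false A ∩ secAt e false B ∩ secAt e false D)))
          + (ex (bernoulliWeight p) (ind (secAt e false B)) * ex (bernoulliWeight p) (ind (secAt e true A))
              - ex (bernoulliWeight p) (ind (secAt e true A ∩ (secAt e false B ∩ secAt e false D)))
              - ex (bernoulliWeight p) (ind (secAt e false A)) * ex (bernoulliWeight p) (ind (secAt e false B))
              + ex (bernoulliWeight p) (ind (secAt e false A ∩ secAt e false B ∩ secAt e false D)))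
          + (2 - ex (bernoulliWeight p) (ind (secAt e true D))) *
            ((ex (bernoulliWeight p) (ind (secAt e true A)) - ex (bernoulliWeight p) (ind (secAt e false A))) *
              (ex (bernoulliWeight p) (ind (secAt e true B)) - ex (bernoulliWeight p) (ind (secAt e false B))))) := by
  -- one-coordinate conditioning of the seven moments
  have hAe : ex (bernoulliWeight p) (ind A) = (p e : ℝ) * ex (bernoulliWeight p) (ind (secAt e true A)) +
      (1 - (p e : ℝ)) * ex (bernoulliWeight p) (ind (secAt e false A)) := ex_ind_eq_secAt p e A
  have hBe : ex (bernoulliWeight p) (ind B) = (p e : ℝ) * ex (bernoulliWeight p) (ind (secAt e true B)) +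
      (1 - (p e : ℝ)) * ex (bernoulliWeight p) (ind (secAt e false B)) := ex_ind_eq_secAt p e B
  have hDe : ex (bernoulliWeight p) (ind D) = (p e : ℝ) * ex (bernoulliWeight p) (ind (secAt e true D)) +
      (1 - (p e : ℝ)) * ex (bernoulliWeight p) (ind (secAt e false D)) := ex_ind_eq_secAt p e D
  have hAB : ex (bernoulliWeight p) (ind (A ∩ B)) = (p e : ℝ) * ex (bernoulliWeight p) (ind (secAt e true A ∩ secAt e true B)) +
      (1 - (p e : ℝ)) * ex (bernoulliWeight p) (ind (secAt e false A ∩ secAt e false B)) := by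
    rw [ex_ind_eq_secAt p e (A ∩ B), secAt_inter, secAt_inter]
  have hAD : ex (bernoulliWeight p) (ind (A ∩ D)) = (p e : ℝ) * ex (bernoulliWeight p) (ind (secAt e true A ∩ secAt e true D)) +
      (1 - (p e : ℝ)) * ex (bernoulliWeight p) (ind (secAt e false A ∩ secAt e false D)) := by
    rw [ex_ind_eq_secAt p e (A ∩ D), secAt_inter, secAt_inter]
  have hBD : ex (bernoulliWeight p) (ind (B ∩ D)) = (p e : ℝ) * ex (bernoulliWeight p) (ind (secAt e true B ∩ secAt e true D)) +
      (1 - (p e : ℝ)) * ex (bernoulliWeight p) (ind (secAt e false B ∩ secAt e false D)) := by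
    rw [ex_ind_eq_secAt p e (B ∩ D), secAt_inter, secAt_inter]
  have hABD : ex (bernoulliWeight p) (ind (A ∩ B ∩ D)) =
      (p e : ℝ) * ex (bernoulliWeight p) (ind (secAt e true A ∩ secAt e true B ∩ secAt e true D)) +
      (1 - (p e : ℝ)) * ex (bernoulliWeight p) (ind (secAt e false A ∩ secAt e false B ∩ secAt e false D)) := by
    rw [ex_ind_eq_secAt p e (A ∩ B ∩ D), secAt_inter, secAt_inter, secAt_inter, secAt_inter]
  -- the block factorisations
  have f00 : ex (bernoulliWeight p) (ind (secAt e false A ∩ secAt e false B)) =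
      ex (bernoulliWeight p) (ind (secAt e false A)) * ex (bernoulliWeight p) (ind (secAt e false B)) :=
    ex_ind_inter_of_separated p F (hA false) (hB false)
  have f11 : ex (bernoulliWeight p) (ind (secAt e true A ∩ secAt e true B)) =
      ex (bernoulliWeight p) (ind (secAt e true A)) * ex (bernoulliWeight p) (ind (secAt e true B)) :=
    ex_ind_inter_of_separated p F (hA true) (hB true)
  -- absorption on the `1`-side
  have g1 : ex (bernoulliWeight p) (ind (secAt e true A ∩ secAt e true D)) = ex (bernoulliWeight p) (ind (secAt e true A)) :=
    ex_ind_inter_of_subset _ hDA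
  have g2 : ex (bernoulliWeight p) (ind (secAt e true B ∩ secAt e true D)) = ex (bernoulliWeight p) (ind (secAt e true B)) :=
    ex_ind_inter_of_subset _ hDB
  have g3 : ex (bernoulliWeight p) (ind (secAt e true A ∩ secAt e true B ∩ secAt e true D)) =
      ex (bernoulliWeight p) (ind (secAt e true A)) * ex (bernoulliWeight p) (ind (secAt e true B)) := by
    rw [Set.inter_eq_left.2 (Set.inter_subset_left.trans hDA), f11]
  -- the mixed moments on the right: `m(Y ∩ (A⁰ ∩ C))`, `m(X ∩ (B⁰ ∩ C))` stay atoms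
  rw [sahiE_three]
  simp only [ind_mul_ind_eq_inter]
  rw [hAe, hBe, hDe, hAB, hAD, hBD, hABD, f00, f11, g1, g2, g3]
  ring

end Identity

/-! ### 2. `C_3` on the class, unconditionally -/

section Consequences

variable {p : ι → unitInterval} {e : ι} {F : Finset ι} {A B D : Set (Set ι)}

/-- The cell `m A⁰·m Y − m(Y∩(A⁰∩C)) − m A⁰·m B⁰ + m(A⁰∩B⁰∩C)` is the probability `μ(A⁰ ∩ (Y∖B⁰) ∩ Cᶜ)` (block factorisation). [this work] -/
theorem blocks_cell_eq (p : ι → unitInterval) (e : ι) (F : Finset ι) (A B D : Set (Set ι)) (hBu : IsUpperSet B)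
    (hA : ∀ b : Bool, DeterminedBy (secAt e b A) (↑F : Set ι)) (hB : ∀ b : Bool, DeterminedBy (secAt e b B) (↑F : Set ι)ᶜ) :
    ex (bernoulliWeight p) (ind (secAt e false A)) * ex (bernoulliWeight p) (ind (secAt e true B))
        - ex (bernoulliWeight p) (ind (secAt e true B ∩ (secAt e false A ∩ secAt e false D)))
        - ex (bernoulliWeight p) (ind (secAt e false A)) * ex (bernoulliWeight p) (ind (secAt e false B))
        + ex (bernoulliWeight p) (ind (secAt e false A ∩ secAt e false B ∩ secAt e false D)) =
      ex (bernoulliWeight p) (ind (secAt e false A ∩ (secAt e true B \ secAt e false B) ∩ (secAt e false D)ᶜ)) := by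
  rw [ex_ind_inter_sdiff_inter_compl _ _ (RigidityAll.secAt_false_subset_secAt_true e hBu),
    ex_ind_inter_of_separated p F (hA false) (hB true), ex_ind_inter_of_separated p F (hA false) (hB false)]
  have h1 : secAt e true B ∩ (secAt e false A ∩ secAt e false D) = secAt e false A ∩ secAt e true B ∩ secAt e false D := by
    ext ω; simp only [Set.mem_inter_iff]; tauto
  rw [h1]

/-- The mirror cell (roles of `A` and `B` exchanged). [this work] -/
theorem blocks_cell_eq' (p : ι → unitInterval) (e : ι) (F : Finset ι) (A B D : Set (Set ι)) (hAu : IsUpperSet A)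
    (hA : ∀ b : Bool, DeterminedBy (secAt e b A) (↑F : Set ι)) (hB : ∀ b : Bool, DeterminedBy (secAt e b B) (↑F : Set ι)ᶜ) :
    ex (bernoulliWeight p) (ind (secAt e false B)) * ex (bernoulliWeight p) (ind (secAt e true A))
        - ex (bernoulliWeight p) (ind (secAt e true A ∩ (secAt e false B ∩ secAt e false D)))
        - ex (bernoulliWeight p) (ind (secAt e false A)) * ex (bernoulliWeight p) (ind (secAt e false B))
        + ex (bernoulliWeight p) (ind (secAt e false A ∩ secAt e false B ∩ secAt e false D)) =
      ex (bernoulliWeight p) (ind (secAt e false B ∩ (secAt e true A \ secAt e false A) ∩ (secAt e false D)ᶜ)) := by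
  rw [ex_ind_inter_sdiff_inter_compl _ _ (RigidityAll.secAt_false_subset_secAt_true e hAu)]
  have e1 : ex (bernoulliWeight p) (ind (secAt e false B ∩ secAt e true A)) =
      ex (bernoulliWeight p) (ind (secAt e false B)) * ex (bernoulliWeight p) (ind (secAt e true A)) := by
    rw [Set.inter_comm, ex_ind_inter_of_separated p F (hA true) (hB false), mul_comm]
  have e2 : ex (bernoulliWeight p) (ind (secAt e false B ∩ secAt e false A)) =
      ex (bernoulliWeight p) (ind (secAt e false A)) * ex (bernoulliWeight p) (ind (secAt e false B)) := by
    rw [Set.inter_comm, ex_ind_inter_of_separated p F (hA false) (hB false)]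
  have h1 : secAt e true A ∩ (secAt e false B ∩ secAt e false D) = secAt e false B ∩ secAt e true A ∩ secAt e false D := by
    ext ω; simp only [Set.mem_inter_iff]; tauto
  have h2 : secAt e false A ∩ secAt e false B ∩ secAt e false D = secAt e false B ∩ secAt e false A ∩ secAt e false D := by
    ext ω; simp only [Set.mem_inter_iff]; tauto
  rw [e1, e2, h1, h2]

variable (hAu : IsUpperSet A) (hBu : IsUpperSet B) (hDu : IsUpperSet D)
  (hA : ∀ b : Bool, DeterminedBy (secAt e b A) (↑F : Set ι)) (hB : ∀ b : Bool, DeterminedBy (secAt e b B) (↑F : Set ι)ᶜ)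
  (hDA : secAt e true A ⊆ secAt e true D) (hDB : secAt e true B ⊆ secAt e true D)
include hAu hBu hDu hA hB hDA hDB

/-- **`C_3` on the class, at every `p ∈ [0,1]^ι`, unconditionally.** [this work] -/
theorem sahiE_three_blocks_nonneg (p : ι → unitInterval) : 0 ≤ sahiE (bernoulliWeight p) 3 ![ind A, ind B, ind D] := by
  rw [sahiE_three_blocks_eq p e F A B D hA hB hDA hDB, blocks_cell_eq p e F A B D hBu hA hB, blocks_cell_eq' p e F A B D hAu hA hB]
  have ht0 : 0 ≤ (p e : ℝ) := (p e).2.1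
  have ht1 : 0 ≤ 1 - (p e : ℝ) := sub_nonneg.2 (p e).2.2
  have hA0 := isUpperSet_secAt e false hAu
  have hA1 := isUpperSet_secAt e true hAu
  have hB0 := isUpperSet_secAt e false hBu
  have hB1 := isUpperSet_secAt e true hBu
  have hC := isUpperSet_secAt e false hDu
  have c1 : 0 ≤ ex (bernoulliWeight p) (ind (secAt e false A ∩ secAt e false B ∩ secAt e false D)) -
      ex (bernoulliWeight p) (ind (secAt e false A)) * ex (bernoulliWeight p) (ind (secAt e false B ∩ secAt e false D)) := by
    rw [Set.inter_assoc]; exact cov_ind_nonneg p hA0 (hB0.inter hC)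
  have c2 : 0 ≤ ex (bernoulliWeight p) (ind (secAt e false A ∩ secAt e false B ∩ secAt e false D)) -
      ex (bernoulliWeight p) (ind (secAt e false B)) * ex (bernoulliWeight p) (ind (secAt e false A ∩ secAt e false D)) := by
    have h : secAt e false A ∩ secAt e false B ∩ secAt e false D = secAt e false B ∩ (secAt e false A ∩ secAt e false D) := by
      ext ω; simp only [Set.mem_inter_iff]; tauto
    rw [h]; exact cov_ind_nonneg p hB0 (hA0.inter hC)
  have c3 := cov_ind_nonneg p hB1 (hA0.inter hC)
  have c4 := cov_ind_nonneg p hA1 (hB0.inter hC)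
  have m1 := ex_ind_nonneg' p (secAt e false A ∩ (secAt e true B \ secAt e false B) ∩ (secAt e false D)ᶜ)
  have m2 := ex_ind_nonneg' p (secAt e false B ∩ (secAt e true A \ secAt e false A) ∩ (secAt e false D)ᶜ)
  have nA := ex_secAt_true_sub_false_nonneg p e hAu
  have nB := ex_secAt_true_sub_false_nonneg p e hBu
  have gC : 0 ≤ 2 - ex (bernoulliWeight p) (ind (secAt e false D)) := by
    have := one_sub_ex_ind p (secAt e false D); have := ex_ind_nonneg' p (secAt e false D)ᶜ; linarith
  have gG : 0 ≤ 2 - ex (bernoulliWeight p) (ind (secAt e true D)) := by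
    have := one_sub_ex_ind p (secAt e true D); have := ex_ind_nonneg' p (secAt e true D)ᶜ; linarith
  have nn := mul_nonneg nA nB
  have t0 := mul_nonneg (pow_nonneg ht1 3) (add_nonneg c1 c2)
  have t1 := mul_nonneg (mul_nonneg ht0 (pow_nonneg ht1 2))
    (add_nonneg (add_nonneg (add_nonneg (add_nonneg (add_nonneg (add_nonneg c3 c4) c1) c2) m1) m2) (mul_nonneg gC nn))
  have t2 := mul_nonneg (mul_nonneg (pow_nonneg ht0 2) ht1)
    (add_nonneg (add_nonneg (add_nonneg (add_nonneg c4 c3) m1) m2) (mul_nonneg gG nn))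
  linarith

/-- **The pointwise statement on the class**: at interior `p`, `E_3(μ_p; A, B, D) = 0 ↔ (A, B, D) ∈ Z_3` (and `≥ 0`).  Every atom of the
identity vanishes parameter-freely, so a zero at `p` is a zero on the whole open cube, and (EQI-3) concludes. [this work] -/
theorem sahiE_three_blocks_settled {p : ι → unitInterval} (hp : ∀ f, (p f : ℝ) ∈ Set.Ioo (0 : ℝ) 1) :
    0 ≤ sahiE (bernoulliWeight p) 3 (fun j => ind ((![A, B, D] : Fin 3 → Set (Set ι)) j)) ∧
      (sahiE (bernoulliWeight p) 3 (fun j => ind ((![A, B, D] : Fin 3 → Set (Set ι)) j)) = 0 ↔ SuppZeroFlag 3 ![A, B, D]) := by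
  have hU : ∀ j, IsUpperSet ((![A, B, D] : Fin 3 → Set (Set ι)) j) := by
    intro j; fin_cases j
    · exact hAu
    · exact hBu
    · exact hDu
  have hv : (fun j => ind ((![A, B, D] : Fin 3 → Set (Set ι)) j)) = ![ind A, ind B, ind D] := by
    funext j; fin_cases j <;> rfl
  rw [hv]
  refine ⟨sahiE_three_blocks_nonneg hAu hBu hDu hA hB hDA hDB p, fun hz => ?_, fun hZ => ?_⟩
  swap
  · have := masterFamilyEqIff_mpr 3 ι p _ hZ; rwa [hv] at this
  refine suppZeroFlag_of_eq_zero_on_paramBox _ hU (a := fun _ => 0) (b := fun _ => 1) (fun _ => zero_lt_one) (fun _ => le_rfl)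
    (fun _ => le_rfl) fun q hq => ?_
  rw [hv]
  -- atoms at `p`
  have ht0 : 0 < (p e : ℝ) := (hp e).1
  have ht1 : 0 < 1 - (p e : ℝ) := sub_pos.2 (hp e).2
  have hA0 := isUpperSet_secAt e false hAu
  have hA1 := isUpperSet_secAt e true hAu
  have hB0 := isUpperSet_secAt e false hBu
  have hB1 := isUpperSet_secAt e true hBu
  have hC := isUpperSet_secAt e false hDu
  have s1 : secAt e false A ∩ secAt e false B ∩ secAt e false D = secAt e false A ∩ (secAt e false B ∩ secAt e false D) := Set.inter_assoc _ _ _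
  have s2 : secAt e false A ∩ secAt e false B ∩ secAt e false D = secAt e false B ∩ (secAt e false A ∩ secAt e false D) := by
    ext ω; simp only [Set.mem_inter_iff]; tauto
  have c1 : 0 ≤ ex (bernoulliWeight p) (ind (secAt e false A ∩ secAt e false B ∩ secAt e false D)) -
      ex (bernoulliWeight p) (ind (secAt e false A)) * ex (bernoulliWeight p) (ind (secAt e false B ∩ secAt e false D)) := by
    rw [s1]; exact cov_ind_nonneg p hA0 (hB0.inter hC)
  have c2 : 0 ≤ ex (bernoulliWeight p) (ind (secAt e false A ∩ secAt e false B ∩ secAt e false D)) -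
      ex (bernoulliWeight p) (ind (secAt e false B)) * ex (bernoulliWeight p) (ind (secAt e false A ∩ secAt e false D)) := by
    rw [s2]; exact cov_ind_nonneg p hB0 (hA0.inter hC)
  have c3 := cov_ind_nonneg p hB1 (hA0.inter hC)
  have c4 := cov_ind_nonneg p hA1 (hB0.inter hC)
  have m1 := ex_ind_nonneg' p (secAt e false A ∩ (secAt e true B \ secAt e false B) ∩ (secAt e false D)ᶜ)
  have m2 := ex_ind_nonneg' p (secAt e false B ∩ (secAt e true A \ secAt e false A) ∩ (secAt e false D)ᶜ)
  have nA := ex_secAt_true_sub_false_nonneg p e hAu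
  have nB := ex_secAt_true_sub_false_nonneg p e hBu
  have gC : 1 ≤ 2 - ex (bernoulliWeight p) (ind (secAt e false D)) := by
    have := one_sub_ex_ind p (secAt e false D); have := ex_ind_nonneg' p (secAt e false D)ᶜ; linarith
  have gG : 1 ≤ 2 - ex (bernoulliWeight p) (ind (secAt e true D)) := by
    have := one_sub_ex_ind p (secAt e true D); have := ex_ind_nonneg' p (secAt e true D)ᶜ; linarith
  have nn := mul_nonneg nA nB
  have hz' := hz
  rw [sahiE_three_blocks_eq p e F A B D hA hB hDA hDB, blocks_cell_eq p e F A B D hBu hA hB, blocks_cell_eq' p e F A B D hAu hA hB] at hz'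
  -- the three weighted groups vanish, hence every atom vanishes at `p`
  have w0 := mul_nonneg (pow_nonneg ht1.le 3) (add_nonneg c1 c2)
  have w1 := mul_nonneg (mul_nonneg ht0.le (pow_nonneg ht1.le 2))
    (add_nonneg (add_nonneg (add_nonneg (add_nonneg (add_nonneg (add_nonneg c3 c4) c1) c2) m1) m2)
      (mul_nonneg (by linarith : (0:ℝ) ≤ 2 - ex (bernoulliWeight p) (ind (secAt e false D))) nn))
  have w2 := mul_nonneg (mul_nonneg (pow_nonneg ht0.le 2) ht1.le)
    (add_nonneg (add_nonneg (add_nonneg (add_nonneg c4 c3) m1) m2) (mul_nonneg (by linarith : (0:ℝ) ≤ 2 - ex (bernoulliWeight p) (ind (secAt e true D))) nn))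
  have g2 : (p e : ℝ) ^ 2 * (1 - (p e : ℝ)) *
      ((ex (bernoulliWeight p) (ind (secAt e true A ∩ (secAt e false B ∩ secAt e false D))) -
          ex (bernoulliWeight p) (ind (secAt e true A)) * ex (bernoulliWeight p) (ind (secAt e false B ∩ secAt e false D)))
        + (ex (bernoulliWeight p) (ind (secAt e true B ∩ (secAt e false A ∩ secAt e false D))) -
          ex (bernoulliWeight p) (ind (secAt e true B)) * ex (bernoulliWeight p) (ind (secAt e false A ∩ secAt e false D)))
        + ex (bernoulliWeight p) (ind (secAt e false A ∩ (secAt e true B \ secAt e false B) ∩ (secAt e false D)ᶜ))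
        + ex (bernoulliWeight p) (ind (secAt e false B ∩ (secAt e true A \ secAt e false A) ∩ (secAt e false D)ᶜ))
        + (2 - ex (bernoulliWeight p) (ind (secAt e true D))) *
          ((ex (bernoulliWeight p) (ind (secAt e true A)) - ex (bernoulliWeight p) (ind (secAt e false A))) *
            (ex (bernoulliWeight p) (ind (secAt e true B)) - ex (bernoulliWeight p) (ind (secAt e false B))))) = 0 := by
    linarith
  have g2' := (mul_eq_zero.1 g2).resolve_left (mul_ne_zero (pow_ne_zero 2 ht0.ne') ht1.ne')
  have g0 : (1 - (p e : ℝ)) ^ 3 *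
      ((ex (bernoulliWeight p) (ind (secAt e false A ∩ secAt e false B ∩ secAt e false D)) -
          ex (bernoulliWeight p) (ind (secAt e false A)) * ex (bernoulliWeight p) (ind (secAt e false B ∩ secAt e false D)))
        + (ex (bernoulliWeight p) (ind (secAt e false A ∩ secAt e false B ∩ secAt e false D)) -
          ex (bernoulliWeight p) (ind (secAt e false B)) * ex (bernoulliWeight p) (ind (secAt e false A ∩ secAt e false D)))) = 0 := by
    linarith
  have g0' := (mul_eq_zero.1 g0).resolve_left (pow_ne_zero 3 ht1.ne')
  have z1 : ex (bernoulliWeight p) (ind (secAt e false A ∩ secAt e false B ∩ secAt e false D)) -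
      ex (bernoulliWeight p) (ind (secAt e false A)) * ex (bernoulliWeight p) (ind (secAt e false B ∩ secAt e false D)) = 0 := by linarith
  have z2 : ex (bernoulliWeight p) (ind (secAt e false A ∩ secAt e false B ∩ secAt e false D)) -
      ex (bernoulliWeight p) (ind (secAt e false B)) * ex (bernoulliWeight p) (ind (secAt e false A ∩ secAt e false D)) = 0 := by linarith
  have pn : 0 ≤ (2 - ex (bernoulliWeight p) (ind (secAt e true D))) *
      ((ex (bernoulliWeight p) (ind (secAt e true A)) - ex (bernoulliWeight p) (ind (secAt e false A))) *
        (ex (bernoulliWeight p) (ind (secAt e true B)) - ex (bernoulliWeight p) (ind (secAt e false B)))) := mul_nonneg (by linarith) nn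
  have z3 : ex (bernoulliWeight p) (ind (secAt e true B ∩ (secAt e false A ∩ secAt e false D))) -
      ex (bernoulliWeight p) (ind (secAt e true B)) * ex (bernoulliWeight p) (ind (secAt e false A ∩ secAt e false D)) = 0 := by linarith
  have z4 : ex (bernoulliWeight p) (ind (secAt e true A ∩ (secAt e false B ∩ secAt e false D))) -
      ex (bernoulliWeight p) (ind (secAt e true A)) * ex (bernoulliWeight p) (ind (secAt e false B ∩ secAt e false D)) = 0 := by linarith
  have z5 : ex (bernoulliWeight p) (ind (secAt e false A ∩ (secAt e true B \ secAt e false B) ∩ (secAt e false D)ᶜ)) = 0 := by linarith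
  have z6 : ex (bernoulliWeight p) (ind (secAt e false B ∩ (secAt e true A \ secAt e false A) ∩ (secAt e false D)ᶜ)) = 0 := by linarith
  have z7 : (ex (bernoulliWeight p) (ind (secAt e true A)) - ex (bernoulliWeight p) (ind (secAt e false A))) *
      (ex (bernoulliWeight p) (ind (secAt e true B)) - ex (bernoulliWeight p) (ind (secAt e false B))) = 0 := by
    have h7 : (2 - ex (bernoulliWeight p) (ind (secAt e true D))) *
        ((ex (bernoulliWeight p) (ind (secAt e true A)) - ex (bernoulliWeight p) (ind (secAt e false A))) *
          (ex (bernoulliWeight p) (ind (secAt e true B)) - ex (bernoulliWeight p) (ind (secAt e false B)))) = 0 := by linarith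
    exact (mul_eq_zero.1 h7).resolve_left (by linarith)
  -- transfer every atom to `q`
  have T1 : ex (bernoulliWeight q) (ind (secAt e false A ∩ secAt e false B ∩ secAt e false D)) -
      ex (bernoulliWeight q) (ind (secAt e false A)) * ex (bernoulliWeight q) (ind (secAt e false B ∩ secAt e false D)) = 0 := by
    rw [s1] at z1 ⊢; exact cov_ind_eq_zero_transfer hp q hA0 (hB0.inter hC) z1
  have T2 : ex (bernoulliWeight q) (ind (secAt e false A ∩ secAt e false B ∩ secAt e false D)) -
      ex (bernoulliWeight q) (ind (secAt e false B)) * ex (bernoulliWeight q) (ind (secAt e false A ∩ secAt e false D)) = 0 := by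
    rw [s2] at z2 ⊢; exact cov_ind_eq_zero_transfer hp q hB0 (hA0.inter hC) z2
  have T3 := cov_ind_eq_zero_transfer hp q hB1 (hA0.inter hC) z3
  have T4 := cov_ind_eq_zero_transfer hp q hA1 (hB0.inter hC) z4
  have T5 := ex_ind_eq_zero_transfer hp q _ z5
  have T6 := ex_ind_eq_zero_transfer hp q _ z6
  have T7 : (ex (bernoulliWeight q) (ind (secAt e true A)) - ex (bernoulliWeight q) (ind (secAt e false A))) *
      (ex (bernoulliWeight q) (ind (secAt e true B)) - ex (bernoulliWeight q) (ind (secAt e false B))) = 0 := by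
    rcases mul_eq_zero.1 z7 with h | h
    · rw [ex_secAt_sub_eq_zero_transfer hp q e hAu h, zero_mul]
    · rw [ex_secAt_sub_eq_zero_transfer hp q e hBu h, mul_zero]
  rw [sahiE_three_blocks_eq q e F A B D hA hB hDA hDB, blocks_cell_eq q e F A B D hBu hA hB, blocks_cell_eq' q e F A B D hAu hA hB,
    T1, T2, T3, T4, T5, T6]
  have T7a : (2 - ex (bernoulliWeight q) (ind (secAt e false D))) *
      ((ex (bernoulliWeight q) (ind (secAt e true A)) - ex (bernoulliWeight q) (ind (secAt e false A))) *
        (ex (bernoulliWeight q) (ind (secAt e true B)) - ex (bernoulliWeight q) (ind (secAt e false B)))) = 0 := by rw [T7, mul_zero]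
  have T7b : (2 - ex (bernoulliWeight q) (ind (secAt e true D))) *
      ((ex (bernoulliWeight q) (ind (secAt e true A)) - ex (bernoulliWeight q) (ind (secAt e false A))) *
        (ex (bernoulliWeight q) (ind (secAt e true B)) - ex (bernoulliWeight q) (ind (secAt e false B)))) = 0 := by rw [T7, mul_zero]
  rw [T7a, T7b]
  ring

end Consequences

end Pointwise

end Summit.CriticalPhenomena.PercolationContinuityZ3.Theorems
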